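import Summits.QuantumFields.BalabanUV.Beta.EriceRemainderEnclosureHistoryAutonomyComparisonAgeCompositionStaticEndDecay
import Summits.QuantumFields.BalabanUV.Beta.EriceRemainderEnclosureHistoryAutonomyComparisonAgeCompositionStaticEndOldestFlow

/-!
# EriceRemainderEnclosureHistoryAutonomyComparisonAgeCompositionStaticEndDecayFlow — (E83k) route (N), first order: (E83j)'s END FOR THE FLOW, and THE
# TWO-AGE END ON THE STATIC DECAY FAMILY (S-d) ALONE — for every box solution dominated by `{1, k}` and every damping in the relaxed class — the one
# remaining static hypothesis being the one the numerics show ROBUST (ratio ≤ 0.85 everywhere, ≤ 0.70 at the adversarial pins), unlike (S-a)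

Cell `pub-balaban`, β-function sub-cell, BINDER row D4 «RemainderConst leaves for Bałaban's split» (`HOME/BINDER-OWNERS.md`; owner lineage `b2b-balaban-beta-an4`;
this file by co-owner #2 lineage `b2b-balaban-beta-d4-p2`, generation 74), β-FLOW TEAM duty (1), FREEZE (0) honoured (def-free; imports (E83j) `…StaticEndDecay`
and (E82e) `…StaticEndOldestFlow`; uses (E75a), (E80e), (E81d), (E81i), (E82c), (E82e), (E83j) BY NAME; the wrappers are (E83h)'s with (S-a) traded for (S-d)).

HONEST FRAMING (page 1, verbatim and binding).  *"Discharging BetaPertH makes Bałaban's UV stability UNCONDITIONAL — a real constructive-QFT result; it is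
NOT the continuum limit and NOT the Clay problem."*  THIS FILE DISCHARGES NOTHING OF THE KIND.  Elementary real analysis about ABSTRACT functionals on a box
]0,γ]^ℕ with displayed floors, profiles and signs, and the FIRST-ORDER renewal objects of route (N) built from them — hypotheses of a census, not facts; the
form, signs, ages and moments of Bałaban's (1.22) limit functional are NOT PRINTED ([I] p. 298; GAPS G-t4-U2-1∕-2) and NOT asserted.  Row D4 class
UNCHANGED (critical-path width 0; instance 0∕1; D4 DISCHARGE NO DATE).  HONEST DEPENDENCY: continuum YM on T⁴ ⇐ BetaPertH ∧ nine spine estimates (0/9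
proved); BetaPertH ⇐ (D1) ∧ (D4) ∧ CAP+tail; G-an2-4 gates asym, D1 and NE2/3/4.

THE POINT (census sense (α); route (N); README `HOME/b2b-balaban-beta-d4-p2/g74/e83/README.md` §4 (1)).  §1 **`flow_nonneg_of_static_families_decay`**:
(E82e)'s wrapper on (E83j) `nonneg_of_static_families_decay` — shift domination is automatic along flows ((E81d) `flow_shift_domination`); the per-pair option
`hMONOopt` (cumulative domination ∨ silent young level ∨ one-lag young level with (S-d)) is passed through.  §2 **`flow_nonneg_two_ages_decay`**: for a two-age
profile `{1, k}` (`2 ≤ k`, horizon `K = k + 1`), every box solution and every damping with `1∕(1+F_t) ≤ g_t ≤ 1`, the first-order comparison surplus of every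
admissible excess is non-negative GIVEN ONLY the static decay family **(S-d): for every pin `m`,
`KL k (m+1) (k−1)·KL 1 (m+1+k) 0·Π_{p∈[m+2,m+2+k)} Hg 1 p ≤ KL k m 0·KL 1 (m+1) 0·(1 − KL 1 (m+2) 0·Hg 1 (m+2))`** — «entering entry × young entry one window
deeper × growth of the old surplus across the window ≤ leaving entry × young entry × (1 − young entry × growth)»; the pairs `(1, k′)` with `k′` silent and
`(i ≥ 2, ·)` are served by the silent options, the age 1's (S-b) by (E82c), the oldest age by (E83e)∕(E83g).  NUMERICS OF RECORD (`g74/numerics/o10.py`; kit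
j330221∕j330222 for k ≤ 256): (S-d) ratio ≤ 0.845 along every two-age flow tested (five load regimes, classes one∕self∕lower, k ≤ 16; worst deep in the
ultraviolet, margin first order in the loads: young-coefficient decay `≈ 3k(c¹+c)` against window damping + growth `≈ k(c¹+c)`), ≤ 0.70 at the adversarial
relaxed pins where (S-a) reaches 0.9999 (k = 64) and fails beyond.  Together with (E83h) (`flow_nonneg_two_ages_rowmass`: (S-a) alone;
`flow_nonneg_two_ages_undamped`: nothing) this leaves the damped two-age END resting on ONE static family with a first-order margin.  NOT CLAIMED: (S-d)
along flows (successor item (1)); three or more loaded ages; anything nonlinear; anything printed.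

WHAT IS PROVED ([folklore]; 0 `def`, 0 sorry).  §1 **`flow_nonneg_of_static_families_decay`**; §2 **`flow_nonneg_two_ages_decay`**.
-/
noncomputable section
open Finset

namespace Summit.QuantumFields.BalabanUV.Beta.EriceRemainderEnclosureHistoryAutonomyComparisonAgeCompositionStaticEndDecayFlow

open Literature.MathematicalPhysics.QuantumFieldTheory.Balaban1983to89
open Literature.MathematicalPhysics.QuantumFieldTheory.Balaban1983to89.T4BetaStationary
open Literature.MathematicalPhysics.QuantumFieldTheory.Balaban1983to89.T4BetaFlowWellPosed
open Summit.QuantumFields.BalabanUV.Beta.EriceRemainderEnclosureHistoryAutonomyOrder (strictAnti_of_memFlow)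
open Summit.QuantumFields.BalabanUV.Beta.EriceRemainderEnclosureHistoryAutonomyComparisonAgeCompositionIdentification
open Summit.QuantumFields.BalabanUV.Beta.EriceRemainderEnclosureHistoryAutonomyComparisonAgeCompositionChainWiringAtPin
open Summit.QuantumFields.BalabanUV.Beta.EriceRemainderEnclosureHistoryAutonomyComparisonAgeCompositionCriteriaFlow
open Summit.QuantumFields.BalabanUV.Beta.EriceRemainderEnclosureHistoryAutonomyComparisonAgeCompositionStaticEndFlow
open Summit.QuantumFields.BalabanUV.Beta.EriceRemainderEnclosureHistoryAutonomyComparisonAgeCompositionStaticEndOldestFlow (silent_row silent_tail_sums)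
open Summit.QuantumFields.BalabanUV.Beta.EriceRemainderEnclosureHistoryAutonomyComparisonAgeCompositionStaticEndDecay
open Summit.QuantumFields.BalabanUV.Beta.EriceRemainderEnclosureHistoryAutonomyComparisonAgeCompositionYoungestTailSumWiring

variable {B : (ℕ → ℝ) → ℝ} {γ b gIR : ℝ} {L : ℕ → ℝ} {K : ℕ} {h g : ℕ → ℝ} {KL : ℕ → ℕ → ℕ → ℝ}

/-! ## §1 (E83j)'s END for the flow -/

/-- **ROUTE (N), FIRST ORDER, END FOR THE FLOW — (S-a) OPTIONAL PER PAIR.**  As (E83h) `flow_nonneg_of_static_families_levels` on (E83j)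
`nonneg_of_static_families_decay`: instead of (S-a) for every age `≥ 2`, the per-pair option `hMONOopt` (cumulative domination of `KL k` ∨ `KL i ≡ 0` ∨ `i = 1`
with (S-d) for `(1, k)`); shift domination inside the windows is (E81d) `flow_shift_domination`. [folklore] -/
theorem flow_nonneg_of_static_families_decay (hmono : ∀ u v : ℕ → ℝ, SeqBox γ u → SeqBox γ v → (∀ j, u j ≤ v j) → B u ≤ B v)
    (hL : ∀ k, 0 ≤ L k) (hb : 0 < b) (hlo : ∀ u, SeqBox γ u → b ≤ B u) (hdom : ∀ u, SeqBox γ u → ∑ k ∈ range K, L k * u k ≤ B u)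
    (hh : SeqBox γ h) (hf : MemFlow B gIR h)
    (hg : ∀ t, 0 < g t ∧ g t ≤ 1) (hgF : ∀ t, 1 / (1 + ∑ k ∈ range K, L k * h (t + k) ^ 3 / 2) ≤ g t) (hK : 2 ≤ K)
    (hKL : ∀ k n l, KL k n l = if 0 < k ∧ k < K ∧ l < k then L k * h (n + k) ^ 3 / 2 * ∏ t ∈ Ico (n + 1 + l) (n + k + 1), g t else 0)
    {θ : ℕ → ℕ → ℕ → ℝ} (hθ : ∀ k n l, θ k n l = 1 - (h (n + k + l) / h (n + k)) ^ 3 * ∏ t ∈ Ico (n + k + 1) (n + k + l + 1), g t)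
    {KA : ℕ → ℕ → ℕ → ℝ} {RL RA SL SA : ℕ → (ℕ → ℝ) → ℕ → ℝ}
    (hRL : ∀ i v m, RL i v m = ∑ l ∈ range K, KL i m l * v (m + 1 + l))
    (hRA : ∀ i v m, RA i v m = ∑ l ∈ range K, KA i m l * v (m + 1 + l))
    (hKA : ∀ i m l, KA i m l = KL i m l + KA (i + 1) m l) (hKAtop : ∀ m l, KA K m l = 0)
    (hSL : ∀ i (w : ℕ → ℝ), (∀ m, K < m → w m = 0) → (∀ m, K < m → SL i w m = 0) ∧ ∀ m, SL i w m = w m - RL i (SL i w) m)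
    (hSA : ∀ i (w : ℕ → ℝ), (∀ m, K < m → w m = 0) → (∀ m, K < m → SA i w m = 0) ∧ ∀ m, SA i w m = w m - RA i (SA i w) m)
    {ρ : ℕ → ℕ → ℝ} {β : ℕ → ℕ → ℕ → ℝ}
    (hρ : ∀ i n, 1 ≤ i → i ≤ K - 1 → ρ i n = (∑ l ∈ range K, KL i n l) * (1 + ∑ k ∈ Ioc i (K - 1), θ k n i * β (i + 1) n k) /
      (1 - ∑ k ∈ Ioc i (K - 1), ∑ l ∈ range i, KL k n l))
    (hβnew : ∀ i n, 1 ≤ i → i ≤ K - 1 → β i n i = ρ i n / (1 - ρ i n))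
    (hβold : ∀ i n k, 1 ≤ i → i < k → k ≤ K - 1 → β i n k = β (i + 1) n k / (1 - ρ i n))
    {Hg : ℕ → ℕ → ℝ} (hH : ∀ i m, Hg i m = (1 + ∑ k ∈ Ioc i (K - 1), θ k m 1 * β (i + 1) m k) / (1 - ∑ k ∈ Ioc i (K - 1), KL k m 0))
    (hMONOopt : ∀ i k, 1 ≤ i → i < k → k ≤ K - 1 →
      (∀ m M', ∑ l ∈ range (M' + 1), KL k (m + 1) l ≤ ∑ l ∈ range (M' + 2), KL k m l) ∨ (∀ m l, KL i m l = 0) ∨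
      (i = 1 ∧ ∀ m, KL k (m + 1) (k - 1) * KL i (m + 1 + k) 0 * ∏ p ∈ Ico (m + 2) (m + 2 + k), Hg i p ≤
        KL k m 0 * KL i (m + 1) 0 * (1 - KL i (m + 2) 0 * Hg i (m + 2))))
    {M : ℕ → ℕ → ℝ} (hM : ∀ i m, M i m = KL i m 0 + ∑ l ∈ range (K - 1), max (KL i m (l + 1) - KL i (m + 1) l) 0)
    (hSb : ∀ i m, 1 ≤ i → i < K - 1 → ∀ L', L' < i →
      (1 + M i m) * ∑ l ∈ Ico L' i, Hg i (m + 1 + l) * KL i (m + 1) l ≤ ∑ l ∈ Ico L' i, KL i m l)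
    (hSbp : ∀ i m, 1 ≤ i → i < K - 1 → ∀ L₀, L₀ < i → ∀ L', L' ≤ L₀ →
      (1 + M i m) * ∑ l ∈ Ico L' L₀, Hg i (m + 1 + l) * KL i (m + 1) l ≤ ∑ l ∈ Ico L' (L₀ + 1), KL i m l)
    {HgS : ℕ → ℕ → ℕ → ℝ} (hHS : ∀ i j m, HgS i j m = (1 + ∑ k ∈ Ioc i (K - 1), θ k m 1 * β (i + 1) m k) /
      (1 - ∑ k ∈ Ioc i (K - 1), (KL k m 0 - if m + 1 + k ≤ j then KL k (m + 1) (k - 1) else 0)))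
    {P : ℕ → Prop} (hlev : ∀ i, 1 ≤ i → i < K - 1 → i = 1 ∨ (∀ m l, KL i m l = 0) ∨ P (i + 1))
    (hSc : ∀ i m j, 1 ≤ i → i ≤ K - 1 → P i → m + 1 + K ≤ j → ∀ L', L' < K →
      ∑ l ∈ Ico L' K, HgS (i - 1) j (m + 1 + l) * KA i (m + 1) l ≤ ∑ l ∈ Ico L' K, KA i m l)
    (hScp : ∀ i m L₀, 1 ≤ i → i ≤ K - 1 → P i → L₀ < K → ∀ L', L' ≤ L₀ →
      ∑ l ∈ Ico L' L₀, HgS (i - 1) (m + 1 + L₀) (m + 1 + l) * KA i (m + 1) l ≤ ∑ l ∈ Ico L' (L₀ + 1), KA i m l)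
    {e ε : ℕ → ℝ} (he0 : ∀ m, 0 ≤ e m) (hea : ∀ m, e (m + 1) ≤ e m) (het : ∀ m, K < m → e m = 0)
    (hεt : ∀ m, K < m → ε m = 0) (hεrec : ∀ m, ε m = e m - RA 1 ε m) : ∀ m, 0 ≤ ε m := by
  have hh0 : ∀ n, 0 < h n := fun n => (hh n).1
  have hanti := (strictAnti_of_memFlow hb hlo hh hf).antitone
  have hac := fun n i (hi1 : 1 ≤ i) (hiK : i ≤ K - 1) =>
    age_chain_closes hmono hL hb hlo hdom hh hf hg hgF hKL hθ hρ hβnew hβold n hi1 hiK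
  exact nonneg_of_static_families_decay (N := K) (n := K - 1) (y := fun i => i) (KL := KL) (θ := θ)
    (weight_nonneg hL hh0 hg hKL) (weight_eq_zero_of_horizon hKL)
    (fun i m l hl => by rw [hKL, if_neg (fun h3 => by omega)])
    hRL hRA hKA (fun m l => by rw [Nat.sub_add_cancel (by omega : 1 ≤ K)]; exact hKAtop m l) hSL hSA
    (fun i hi1 hiK => ⟨hi1, by omega⟩)
    (defect_nonneg hh0 hanti hg hθ) (persistence hL hh0 hg hKL hθ) (fun k m l l' hll' => defect_mono hh0 hanti hg hθ k m hll')
    hρ hβnew hβold (fun i m hi1 hiK => (hac m i hi1 hiK).2) (fun i m hi1 hiK => (hac m i hi1 hiK).1)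
    (fun k m l hl => flow_shift_domination hL hh0 hanti hg hKL k m l hl)
    (fun i m _ => flow_lag_zero_mass_lt_one hmono hL hb hlo hdom hh hf hg hKL i m) hH hMONOopt hM hSb hSbp hHS hlev hSc hScp he0 hea het hεt hεrec

/-! ## §2 Silent ages: (E82e) `silent_row`, `silent_tail_sums` (imported) -/

/-! ## §2 The two-age END on the static decay family (S-d) ALONE -/

/-- **ROUTE (N), FIRST ORDER, END FOR TWO-AGE FLOWS — ON THE STATIC DECAY FAMILY (S-d), EVERY DAMPING IN THE RELAXED CLASS.**  `B` isotone with floor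
`b > 0` dominated by a two-age profile (`L_j = 0` for `j ∉ {1, k}`, `2 ≤ k`, horizon `K = k + 1`); `h` a box solution; `g` any damping with
`1∕(1+F_t) ≤ g_t ≤ 1`; the first-order objects of route (N) as in (E81k).  THE ONLY HYPOTHESIS: `hSd` — for every pin `m`,
`KL k (m+1) (k−1)·KL 1 (m+1+k) 0·Π_{p∈[m+2,m+2+k)} Hg 1 p ≤ KL k m 0·KL 1 (m+1) 0·(1 − KL 1 (m+2) 0·Hg 1 (m+2))` (kernel entries and the chain's growth
factors only).  CONCLUSION: the comparison surplus `ε` of every admissible excess `e` is non-negative. [folklore] -/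
theorem flow_nonneg_two_ages_decay (hmono : ∀ u v : ℕ → ℝ, SeqBox γ u → SeqBox γ v → (∀ j, u j ≤ v j) → B u ≤ B v)
    (hL : ∀ k, 0 ≤ L k) (hb : 0 < b) (hlo : ∀ u, SeqBox γ u → b ≤ B u) (hdom : ∀ u, SeqBox γ u → ∑ k ∈ range K, L k * u k ≤ B u)
    (hh : SeqBox γ h) (hf : MemFlow B gIR h)
    (hg : ∀ t, 0 < g t ∧ g t ≤ 1) (hgF : ∀ t, 1 / (1 + ∑ k ∈ range K, L k * h (t + k) ^ 3 / 2) ≤ g t)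
    {k : ℕ} (hk2 : 2 ≤ k) (hKk : K = k + 1) (hL2 : ∀ j, j < K → j ≠ 1 → j ≠ k → L j = 0)
    (hKL : ∀ k n l, KL k n l = if 0 < k ∧ k < K ∧ l < k then L k * h (n + k) ^ 3 / 2 * ∏ t ∈ Ico (n + 1 + l) (n + k + 1), g t else 0)
    {θ : ℕ → ℕ → ℕ → ℝ} (hθ : ∀ k n l, θ k n l = 1 - (h (n + k + l) / h (n + k)) ^ 3 * ∏ t ∈ Ico (n + k + 1) (n + k + l + 1), g t)
    {KA : ℕ → ℕ → ℕ → ℝ} {RL RA SL SA : ℕ → (ℕ → ℝ) → ℕ → ℝ}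
    (hRL : ∀ i v m, RL i v m = ∑ l ∈ range K, KL i m l * v (m + 1 + l))
    (hRA : ∀ i v m, RA i v m = ∑ l ∈ range K, KA i m l * v (m + 1 + l))
    (hKA : ∀ i m l, KA i m l = KL i m l + KA (i + 1) m l) (hKAtop : ∀ m l, KA K m l = 0)
    (hSL : ∀ i (w : ℕ → ℝ), (∀ m, K < m → w m = 0) → (∀ m, K < m → SL i w m = 0) ∧ ∀ m, SL i w m = w m - RL i (SL i w) m)
    (hSA : ∀ i (w : ℕ → ℝ), (∀ m, K < m → w m = 0) → (∀ m, K < m → SA i w m = 0) ∧ ∀ m, SA i w m = w m - RA i (SA i w) m)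
    {ρ : ℕ → ℕ → ℝ} {β : ℕ → ℕ → ℕ → ℝ}
    (hρ : ∀ i n, 1 ≤ i → i ≤ K - 1 → ρ i n = (∑ l ∈ range K, KL i n l) * (1 + ∑ k ∈ Ioc i (K - 1), θ k n i * β (i + 1) n k) /
      (1 - ∑ k ∈ Ioc i (K - 1), ∑ l ∈ range i, KL k n l))
    (hβnew : ∀ i n, 1 ≤ i → i ≤ K - 1 → β i n i = ρ i n / (1 - ρ i n))
    (hβold : ∀ i n k, 1 ≤ i → i < k → k ≤ K - 1 → β i n k = β (i + 1) n k / (1 - ρ i n))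
    {Hg : ℕ → ℕ → ℝ} (hH : ∀ i m, Hg i m = (1 + ∑ k ∈ Ioc i (K - 1), θ k m 1 * β (i + 1) m k) / (1 - ∑ k ∈ Ioc i (K - 1), KL k m 0))
    (hSd : ∀ m, KL k (m + 1) (k - 1) * KL 1 (m + 1 + k) 0 * ∏ p ∈ Ico (m + 2) (m + 2 + k), Hg 1 p ≤
      KL k m 0 * KL 1 (m + 1) 0 * (1 - KL 1 (m + 2) 0 * Hg 1 (m + 2)))
    {M : ℕ → ℕ → ℝ} (hM : ∀ i m, M i m = KL i m 0 + ∑ l ∈ range (K - 1), max (KL i m (l + 1) - KL i (m + 1) l) 0)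
    {HgS : ℕ → ℕ → ℕ → ℝ} (hHS : ∀ i j m, HgS i j m = (1 + ∑ k ∈ Ioc i (K - 1), θ k m 1 * β (i + 1) m k) /
      (1 - ∑ k ∈ Ioc i (K - 1), (KL k m 0 - if m + 1 + k ≤ j then KL k (m + 1) (k - 1) else 0)))
    {e ε : ℕ → ℝ} (he0 : ∀ m, 0 ≤ e m) (hea : ∀ m, e (m + 1) ≤ e m) (het : ∀ m, K < m → e m = 0)
    (hεt : ∀ m, K < m → ε m = 0) (hεrec : ∀ m, ε m = e m - RA 1 ε m) : ∀ m, 0 ≤ ε m := by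
  have hkK : k < K := by omega
  obtain ⟨h1, h1p⟩ := flow_hSb_one hmono hL hb hlo hdom hh hf hg hgF hk2 hkK hL2 hKL hθ hρ hβnew hβold hH hM
  refine flow_nonneg_of_static_families_decay hmono hL hb hlo hdom hh hf hg hgF (by omega) hKL hθ hRL hRA hKA hKAtop hSL hSA hρ hβnew hβold
    hH (fun i k' hi1 hik' hk'K => ?_) hM (fun i m hi1 hiK L' hL' => ?_) (fun i m hi1 hiK L₀ hL₀ L' hL' => ?_) hHS (P := fun _ => False)
    (fun i hi1 hiK => ?_) (fun i m j _ _ hP => hP.elim) (fun i m L₀ _ _ hP => hP.elim) he0 hea het hεt hεrec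
  · -- the per-pair options: (1, k) by (S-d); (1, k') with k' silent by (trivial) cumulative domination; (i ≥ 2, ·) silent young level
    rcases Nat.lt_or_ge i 2 with hi | hi
    · by_cases hkk : k' = k
      · subst hkk; exact Or.inr (Or.inr ⟨by omega, by rw [show i = 1 by omega]; exact hSd⟩)
      · refine Or.inl fun m M' => ?_
        have hz := kernel_zero hKL (hL2 k' (by omega) (by omega) hkk)
        rw [sum_eq_zero fun l _ => hz _ _, sum_eq_zero fun l _ => hz _ _]
    · exact Or.inr (Or.inl fun m l => kernel_zero hKL (hL2 i (by omega) (by omega) (by omega)) m l)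
  · rcases Nat.lt_or_ge i 2 with hi | hi
    · obtain rfl : i = 1 := by omega
      exact h1 m L' hL'
    · exact silent_tail_sums hKL (hL2 i (by omega) (by omega) (by omega)) m _ _
  · rcases Nat.lt_or_ge i 2 with hi | hi
    · obtain rfl : i = 1 := by omega
      exact h1p m L₀ hL₀ L' hL'
    · exact silent_tail_sums hKL (hL2 i (by omega) (by omega) (by omega)) m _ _
  · rcases Nat.lt_or_ge i 2 with hi | hi
    · exact Or.inl (by omega)
    · exact Or.inr (Or.inl fun m l => kernel_zero hKL (hL2 i (by omega) (by omega) (by omega)) m l)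

end Summit.QuantumFields.BalabanUV.Beta.EriceRemainderEnclosureHistoryAutonomyComparisonAgeCompositionStaticEndDecayFlow

end
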